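import Mathlib
import Summits.NavierStokesRegularity.NavierStokesRegularity.Theorems.HeteroclinicTriggerChainTriggerChainFrontStepIgnitionBudget
import HarnessLib

/-!
# `HeteroclinicTriggerChain` — crux `TriggerChainFrontStep` (item stmt-NavierStokesRegularity-22785):
  carrier window with INTEGRATED forcing (segment form) — the wake pump costs its energy, not its sup × time

In the delay phase the carrier surplus `D = x − y` of the forced arc obeys `D′ = −2e·u² + f₁`; the sibling
seat's `heteroclinicTriggerChain_forcedDelayOn_carrier_window` books the forcing at its sup, `|f₁| ≤ φ`, giving
a drift `φ·t` over the window. For the chain the dominant part of `f₁` is the WAKE PUMP `2^{−5/2}g·ω²` of the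
old trigger `ω`, which decays exponentially while it drains its energy `≍ ρδ` into the new carrier; booked at
its sup over the `log(1/β)/e`-long delay this costs `O(δ·log(1/β))` — "too crude by a log" (design note of
seat ns-htc-p5, §6). Booked by its INTEGRAL it costs `O(δ)`. This file gives the integrated form:
* `htcCW_le_of_derivWithin_nonneg` — segment monotonicity helper (companion of `htcIB_le_of_derivWithin_nonpos`);
* `heteroclinicTriggerChain_forcedDelayOn_carrier_window_L1` — `D′ = −2eu² + f₁`, `|u| ≤ h`, `|f₁| ≤ g₁`
  with a primitive `G₁` of `g₁` on the window (`G₁(0) = 0`): `D(0) − 2eh²t − G₁(t) ≤ D(t) ≤ D(0) + G₁(t)`;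
* `heteroclinicTriggerChain_forcedDelayOn_carrier_window_wake` — the instance `|f₁| ≤ A·e^{−κs} + φ`
  (`κ > 0`): `D(0) − 2eh²t − A/κ − φt ≤ D(t) ≤ D(0) + A/κ + φt`, uniformly in the window length.
One-sided derivatives on the window (the regularity of `TaoCascade.PseudoFlowOn`).

HONEST FRAMING: elementary real analysis of a scalar differential inequality on a segment; helper lemmas for
the crux (no stub credit); nothing here is a statement about the Navier–Stokes equations; no summit, rung or
crux is proved. NS regularity is not proved by this line.
-/

noncomputable section

-- the sub-problem namespace `Summit.NavierStokesRegularity.NavierStokesRegularity` repeats the summit name by design (D-0017)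
set_option linter.dupNamespace false

open Real Set

namespace Summit.NavierStokesRegularity.NavierStokesRegularity.Theorems

/-- Segment monotonicity: one-sided derivative `≥ 0` on the open interval ⇒ `F(0) ≤ F(s)` on `[0, T]`.
[folklore] -/
theorem htcCW_le_of_derivWithin_nonneg {F F' : ℝ → ℝ} {T : ℝ}
    (hF : ∀ s ∈ Icc 0 T, HasDerivWithinAt F (F' s) (Icc 0 T) s) (hnn : ∀ s ∈ Ioo 0 T, 0 ≤ F' s) :
    ∀ s ∈ Icc 0 T, F 0 ≤ F s := by
  intro s hs
  have h := htcIB_le_of_derivWithin_nonpos (F := fun r => -F r) (F' := fun r => -F' r)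
    (fun r hr => (hF r hr).neg) (fun r hr => by simpa using hnn r hr) s hs
  simpa using h

/-- **Carrier window with integrated forcing, segment form.** On `[0, T]` (derivatives within the segment)
let `D′ = −2e·u² + f₁` with `e ≥ 0`, `|u| ≤ h`, `|f₁| ≤ g₁`, and let `G₁` be a primitive of `g₁` on the
window with `G₁(0) = 0`. Then `D(0) − 2eh²·t − G₁(t) ≤ D(t) ≤ D(0) + G₁(t)` for `t ∈ [0, T]`. [folklore] -/
theorem heteroclinicTriggerChain_forcedDelayOn_carrier_window_L1 {e h T : ℝ} {D u f₁ g₁ G₁ : ℝ → ℝ}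
    (he : 0 ≤ e)
    (hD : ∀ t ∈ Icc 0 T, HasDerivWithinAt D (-(2 * e * u t ^ 2) + f₁ t) (Icc 0 T) t)
    (hG : ∀ t ∈ Icc 0 T, HasDerivWithinAt G₁ (g₁ t) (Icc 0 T) t) (hG0 : G₁ 0 = 0)
    (hf₁ : ∀ t ∈ Icc 0 T, |f₁ t| ≤ g₁ t) (huh : ∀ t ∈ Icc 0 T, |u t| ≤ h) :
    ∀ t ∈ Icc 0 T, D 0 - 2 * e * h ^ 2 * t - G₁ t ≤ D t ∧ D t ≤ D 0 + G₁ t := by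
  -- upper: D − G₁ non-increasing
  have hU : ∀ t ∈ Icc 0 T, HasDerivWithinAt (fun q => D q - G₁ q) ((-(2 * e * u t ^ 2) + f₁ t) - g₁ t)
      (Icc 0 T) t := fun t ht => (hD t ht).sub (hG t ht)
  have hU' : ∀ t ∈ Ioo 0 T, (-(2 * e * u t ^ 2) + f₁ t) - g₁ t ≤ 0 := by
    intro t ht
    have h1 := (abs_le.1 (hf₁ t (Ioo_subset_Icc_self ht))).2
    have h2 : 0 ≤ 2 * e * u t ^ 2 := by positivity
    linarith
  have hUle := htcIB_le_of_derivWithin_nonpos hU hU'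
  -- lower: D + 2eh² t + G₁ non-decreasing
  have hL : ∀ t ∈ Icc 0 T, HasDerivWithinAt (fun q => D q + 2 * e * h ^ 2 * q + G₁ q)
      ((-(2 * e * u t ^ 2) + f₁ t) + 2 * e * h ^ 2 * 1 + g₁ t) (Icc 0 T) t :=
    fun t ht => ((hD t ht).add ((hasDerivWithinAt_id t _).const_mul _)).add (hG t ht)
  have hL' : ∀ t ∈ Ioo 0 T, 0 ≤ (-(2 * e * u t ^ 2) + f₁ t) + 2 * e * h ^ 2 * 1 + g₁ t := by
    intro t ht
    have ht' := Ioo_subset_Icc_self ht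
    have h1 := (abs_le.1 (hf₁ t ht')).1
    have h2 : u t ^ 2 ≤ h ^ 2 := by
      rw [← sq_abs (u t)]
      exact pow_le_pow_left₀ (abs_nonneg _) (huh t ht') 2
    have h3 : 2 * e * u t ^ 2 ≤ 2 * e * h ^ 2 := mul_le_mul_of_nonneg_left h2 (by positivity)
    linarith
  have hLle := htcCW_le_of_derivWithin_nonneg hL hL'
  intro t ht
  have h1 := hUle t ht
  have h2 := hLle t ht
  simp only [hG0, sub_zero, mul_zero, add_zero] at h1 h2
  constructor <;> linarith

/-- **Carrier window against an exponentially decaying wake pump.** On `[0, T]` let `D′ = −2e·u² + f₁` with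
`e ≥ 0`, `|u| ≤ h` and `|f₁(s)| ≤ A·e^{−κs} + φ` (`A ≥ 0`, `κ > 0`). Then for `t ∈ [0, T]`:
`D(0) − 2eh²t − A/κ − φt ≤ D(t) ≤ D(0) + A/κ + φt` — the wake costs its integral `A/κ`, uniformly in the
window length. [folklore] -/
theorem heteroclinicTriggerChain_forcedDelayOn_carrier_window_wake {e h T A κ φ : ℝ} {D u f₁ : ℝ → ℝ}
    (he : 0 ≤ e) (hA : 0 ≤ A) (hκ : 0 < κ)
    (hD : ∀ t ∈ Icc 0 T, HasDerivWithinAt D (-(2 * e * u t ^ 2) + f₁ t) (Icc 0 T) t)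
    (hf₁ : ∀ t ∈ Icc 0 T, |f₁ t| ≤ A * Real.exp (-(κ * t)) + φ) (huh : ∀ t ∈ Icc 0 T, |u t| ≤ h) :
    ∀ t ∈ Icc 0 T, D 0 - 2 * e * h ^ 2 * t - A / κ - φ * t ≤ D t ∧ D t ≤ D 0 + A / κ + φ * t := by
  -- the primitive G₁(t) = (A/κ)(1 − e^{−κt}) + φ t
  have hG : ∀ t ∈ Icc 0 T, HasDerivWithinAt (fun q => A / κ * (1 - Real.exp (-(κ * q))) + φ * q)
      (A * Real.exp (-(κ * t)) + φ) (Icc 0 T) t := by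
    intro t _
    have h1 : HasDerivAt (fun q => -(κ * q)) (-κ) t := by
      have h := ((hasDerivAt_id t).const_mul κ).neg
      simp only [id_eq, mul_one] at h
      exact h
    have h2 : HasDerivAt (fun q => A / κ * (1 - Real.exp (-(κ * q))) + φ * q)
        (A / κ * (0 - Real.exp (-(κ * t)) * (-κ)) + φ * 1) t :=
      (((hasDerivAt_const t (1 : ℝ)).sub h1.exp).const_mul (A / κ)).add ((hasDerivAt_id' t).const_mul φ)
    have h3 : A / κ * (0 - Real.exp (-(κ * t)) * (-κ)) + φ * 1 = A * Real.exp (-(κ * t)) + φ := by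
      field_simp
      ring
    rw [h3] at h2
    exact h2.hasDerivWithinAt
  have hG0 : (fun q => A / κ * (1 - Real.exp (-(κ * q))) + φ * q) 0 = 0 := by simp
  have hmain := heteroclinicTriggerChain_forcedDelayOn_carrier_window_L1 he hD hG hG0 hf₁ huh
  intro t ht
  obtain ⟨h1, h2⟩ := hmain t ht
  have hE : 0 ≤ Real.exp (-(κ * t)) := (Real.exp_pos _).le
  have h3 : A / κ * (1 - Real.exp (-(κ * t))) ≤ A / κ := by
    have h4 : 1 - Real.exp (-(κ * t)) ≤ 1 := by linarith
    have h5 : 0 ≤ A / κ := by positivity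
    nlinarith
  constructor <;> linarith

end Summit.NavierStokesRegularity.NavierStokesRegularity.Theorems

end
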